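import Summits.KontsevichZagierPeriods.KontsevichZagierPeriods.Theses.SymplecticScissors
import Summits.KontsevichZagierPeriods.KontsevichZagierPeriods.Theorems.RealOnePeriodRelations.Negative.Kit
import Literature.NumberTheory.Transcendental.KZCalculus
import Literature.NumberTheory.Transcendental.CurvePeriods
import Literature.NumberTheory.Transcendental.SemialgebraicMaps

/-!
# `CurvePeriodsTransfer` (stmt-KontsevichZagierPeriods-11129, route SymplecticScissors) —
# line `standard-etale-models`, LEAD SKELETON (re-materialised from the registered stub list, reshape 1)

The crux is LITERALLY `HWBody → RealOnePeriodRelations` (definitionally): the Huber–Wüstholz body (HW 2022,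
Thm 13.3 (2), rendered on period symbols `(Z, ω, γ)` with the elementary relations R1–R5, INLINED in the
crux — this file never names the cite-only tree constant) implies that every
`ℤ`-combination `c ∈ H₁` of 1-dimensional KZ representations with `eval c = 0` lies in
`M₁ = closure (1a ∪ 1b ∪ 2 ∪ Green)` (`M₁`, `H₁`, `crux_iff` from the landed kit
`Theorems/RealOnePeriodRelations/Negative/Kit.lean`).

Line (idea card `Cruxes/CurvePeriodsTransfer/Ideas/standard-etale-models.md`): the composition is
NORMALISATION `Ψ` ∘ Huber–Wüstholz ∘ REALISATION `Θ`:
* `Ψ` (`stub_normalisation`, fed by `stub_pieceReduction` ⇐ `stub_puiseuxGerm` + `stub_saPieceFacts`,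
  `stub_etaleShift`, `stub_sectionSymbol`): every `c ∈ H₁` is, modulo `M₁` (indeed modulo 1a + rule 2 + 1b),
  a sum of REAL REALISATIONS `[∫₀¹ Re(C_s · Σᵢ ωᵢ(γ) γᵢ′) dt]` of period symbols `s = (Z, ω, γ)` of curve
  type along `ℚ`-semialgebraic `C¹` paths, with algebraic coefficients `C_s` and the same evaluation. The
  smooth models are the STANDARD-ÉTALE curves `V_G = {G = 0, x₂·∂₁G = 1} ⊂ 𝔸³` (smooth for EVERY `G`, one
  2×3 minor), the paths are the SECTIONS `s ↦ (s, u(s), 1/∂₁G(s,u(s)))` of normalised pieces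
  `∫₀¹ (T(s) + sᴷ u(s)) ds`, the end point `s = 0` having been made étale by the Taylor shift
  `y = T_K(s) + sᴷ u`, `K > ord₀ ∂_yG(s, g(s))` (`stub_etaleShift`); the pieces come from cutting a
  representation at its finitely many bad (algebraic) points (1a), compactifying and orienting (rule 2) and
  Puiseux-flattening the bad end `x = a + sᵠ` (rule 2; `stub_puiseuxGerm`: a one-sided `ℚ`-semialgebraic
  germ at an algebraic point is `sᵐ·h(s)` after `x = a + sᵠ`, `h` analytic with algebraic Taylor
  coefficients).
* Huber–Wüstholz (the crux's OWN antecedent, no stub): `Ψ(c)` evaluates to `eval c = 0`, so it is a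
  `ℚ̄`-combination `Σ aₗ ρₗ` of elementary relations.
* `Θ` (`stub_realisation`, the Θ-half shared with every line of this crux; its statement is VERBATIM the
  conclusion of `stub_retraction` of the sibling crux stmt-10042's line `nash-retraction-thin-strip`, reshape
  2): a map `Θ : ℂ → PeriodSymbol → FormalRep` killing `ℚ̄`-combinations of R1–R5 modulo `M₁` and agreeing
  modulo `M₁` with every real realisation along a semialgebraic symbol path. Then
  `c ≡ Σ_s [R s] ≡ Σ_s Θ (C s) s = (Σ aₗρₗ).sum Θ ≡ 0 (mod M₁)`.

No local definitions: the two predicates of the line are INLINED in every signature (so that landed stubs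
drop in verbatim and helper files stay `kind = proof`):
* "`γ : ℝ → ℂⁿ` is a `ℚ`-semialgebraic path" ≡
  `IsSemialgebraicMapOn ℚ {z : Fin 1 → ℝ | z 0 ∈ Set.Icc 0 1} (fun z => Fin.append (re ∘ γ (z 0)) (im ∘ γ (z 0)))`;
* "`r` realises `a · (ω, γ)`" ≡
  `r.domain = {z | z 0 ∈ Set.Ioo 0 1} ∧ ∀ z ∈ r.domain, r.integrand z = (a * Σᵢ ωᵢ(γ(z 0)) · γᵢ′(z 0)).re`.

Registered on stmt-KontsevichZagierPeriods-11129 with `ledger skeleton check` (7 stubs = stubs_max):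
`stub_puiseuxGerm` (L, lead), `stub_saPieceFacts` (L), `stub_pieceReduction` (L), `stub_etaleShift` (M),
`stub_sectionSymbol` (M/L), `stub_normalisation` (L, glue), `stub_realisation` (XL, shared Θ).

References: A. Huber, G. Wüstholz, *Transcendence and Linear Relations of 1-Periods* (CUP 2022), Thm 13.3 (2),
Prop. 12.5, §3.3.1, Cor. 12.7; M. Kontsevich, D. Zagier, *Periods* (2001), §1.2; J. Bochnak, M. Coste,
M.-F. Roy, *Real Algebraic Geometry* (1998), §2, §8; J.-P. Serre, *Local Fields*, IV §2 Prop. 8.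
-/

noncomputable section

open scoped BigOperators Topology
open Set MeasureTheory Filter
open Literature.NumberTheory.Transcendental Literature.NumberTheory.Transcendental.CurvePeriods
open Literature.ModelTheory.ExponentialFields (IsSemialgebraic)
open Summit.KontsevichZagierPeriods.SymplecticScissors.RealOnePeriodRelationsNegative (greenSet M₁ H₁)

namespace Summit.KontsevichZagierPeriods.SymplecticScissors.CurvePeriodsTransfer

/-! ## Stubs of the line (registered on stmt-KontsevichZagierPeriods-11129) -/

/-- STUB `stub_puiseuxGerm` (L — the lead's). NORMALISED PUISEUX GERM of a one-sided `ℚ`-semialgebraic germ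
at an algebraic point: if `f` has `ℚ`-semialgebraic graph over `(a, a + δ)` with `a` algebraic, there are
`q ≥ 1`, `m ∈ ℤ` and `h : ℝ → ℝ` analytic at `0` with ALGEBRAIC Taylor coefficients such that
`f (a + sᵠ) = sᵐ · h(s)` for all small `s > 0`, where either `h 0 ≠ 0` (so `m/q` is the Puiseux order of the
germ) or `h ≡ 0` (the zero germ). Newton–Puiseux for the branch of the plane curve of `f` (formal half in tree:
`Literature.FieldTheory.AlgClosed.NewtonPuiseux_holds`; convergence by the holomorphic implicit function theorem
after an étale Taylor shift, or by majorants). [cite: Serre1979, Ch. IV §2 Prop. 8] -/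
theorem stub_puiseuxGerm : ∀ (f : ℝ → ℝ) (a δ : ℝ), IsAlgebraic ℚ a → 0 < δ →
    IsSemialgebraicFunOn ℚ {z : Fin 1 → ℝ | z 0 ∈ Set.Ioo a (a + δ)} (fun z => f (z 0)) →
    ∃ (q : ℕ) (m : ℤ) (h : ℝ → ℝ), 0 < q ∧ AnalyticAt ℝ h 0 ∧ (∀ n, IsAlgebraic ℚ (iteratedDeriv n h 0)) ∧
      (h 0 ≠ 0 ∨ ∀ s, h s = 0) ∧ ∀ᶠ s in 𝓝[>] (0 : ℝ), f (a + s ^ q) = s ^ m * h s := by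
  sorry

/-- STUB `stub_saPieceFacts` (L). STRUCTURE OF ONE-VARIABLE `ℚ`-SEMIALGEBRAIC DATA. (1) A `ℚ`-semialgebraic
subset of `ℝ¹` has finitely many (algebraic) boundary points: membership is constant on every interval avoiding
them. (2) A function with `ℚ`-semialgebraic graph over a bounded open interval `(a, b)` has a finite set `B` of
ALGEBRAIC break points off which, on each complementary open cell `(u, v)`, it is real-analytic and is an ÉTALE
branch of ONE plane curve with algebraic coefficients (`P(x, f x) = 0`, `∂_y P(x, f x) ≠ 0` on the cell), and it
takes algebraic values at algebraic points. (Cell decomposition / monotonicity in dimension one, the Zariski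
closure of a semialgebraic graph, induction on `deg_y` for étaleness, holomorphic IFT + continuity for
analyticity, `ℚ`-definable reals are algebraic.) [cite: BochnakCosteRoy1998, Prop. 2.9.10 and §8.1] -/
theorem stub_saPieceFacts :
    (∀ σ : Set (Fin 1 → ℝ), IsSemialgebraic ℚ σ → ∃ E : Finset ℝ, (∀ e ∈ E, IsAlgebraic ℚ e) ∧
      ∀ x y : ℝ, x < y → (∀ e ∈ E, e ∉ Set.Icc x y) → ((fun _ => x) ∈ σ ↔ (fun _ => y) ∈ σ)) ∧
    (∀ (f : ℝ → ℝ) (a b : ℝ), a < b →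
      IsSemialgebraicFunOn ℚ {z : Fin 1 → ℝ | z 0 ∈ Set.Ioo a b} (fun z => f (z 0)) →
      ∃ B : Finset ℝ, (↑B : Set ℝ) ⊆ Set.Ioo a b ∧ (∀ x ∈ B, IsAlgebraic ℚ x) ∧
        ∀ u v : ℝ, u < v → (u = a ∨ u ∈ B) → (v = b ∨ v ∈ B) → (∀ x ∈ B, x ∉ Set.Ioo u v) →
          ∃ P : MvPolynomial (Fin 2) ℝ, (∀ d, IsAlgebraic ℚ (P.coeff d)) ∧
            ∀ x ∈ Set.Ioo u v, AnalyticAt ℝ f x ∧ MvPolynomial.eval ![x, f x] P = 0 ∧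
              MvPolynomial.eval ![x, f x] (MvPolynomial.pderiv 1 P) ≠ 0 ∧
              (IsAlgebraic ℚ x → IsAlgebraic ℚ (f x))) := by
  sorry

/-- STUB `stub_pieceReduction` (L). PIECE REDUCTION BY MOVES 1a AND 2 ONLY: granted the normalised Puiseux germ
(= `stub_puiseuxGerm`) and the one-variable structure facts (= `stub_saPieceFacts`), every 1-dimensional
representation `r` is, modulo `closure (domainAddRel ∪ changeOfVariablesRel)`, a finite sum of STANDARD PIECES
`[∫_{(0,1)} g_j]`: `g_j` analytic at every point of `[0,1]` with algebraic Taylor coefficients at `0`, algebraic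
value at `1`, `ℚ`-semialgebraic graph over `[0,1]`, and an étale branch on `(0,1]` of a plane curve `G_j = 0`
with algebraic coefficients (`G_j(s, g_j s) = 0` on `[0,1]`, `∂₁G_j(s, g_j s) ≠ 0` on `(0,1]`). Recipe: cut the
domain at its boundary points and the integrand at its break points and at one rational interior point of each
cell (1a; null pieces die by 1a), send unbounded cells to bounded ones and orient each half-cell so that its bad
end is `s = 0` (rule 2, `ℚ̄`-affine / `x ↦ 1/x`), flatten the bad end `x = a + C·sᵠ` (rule 2): by the germ
stub and absolute integrability the new integrand `qC s^{q−1} f(a + C sᵠ) = s^{m+q−1}·(qC·h)` has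
`m + q − 1 ≥ 0`, i.e. is a power series at `0`; the curve is `G(s,y) = (qCs^{q−1})^d P(a + Csᵠ, y/(qCs^{q−1}))`.
[cite: KontsevichZagier2001, §1.2 rules (1), (2)] -/
theorem stub_pieceReduction :
    (∀ (f : ℝ → ℝ) (a δ : ℝ), IsAlgebraic ℚ a → 0 < δ →
      IsSemialgebraicFunOn ℚ {z : Fin 1 → ℝ | z 0 ∈ Set.Ioo a (a + δ)} (fun z => f (z 0)) →
      ∃ (q : ℕ) (m : ℤ) (h : ℝ → ℝ), 0 < q ∧ AnalyticAt ℝ h 0 ∧ (∀ n, IsAlgebraic ℚ (iteratedDeriv n h 0)) ∧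
        (h 0 ≠ 0 ∨ ∀ s, h s = 0) ∧ ∀ᶠ s in 𝓝[>] (0 : ℝ), f (a + s ^ q) = s ^ m * h s) →
    ((∀ σ : Set (Fin 1 → ℝ), IsSemialgebraic ℚ σ → ∃ E : Finset ℝ, (∀ e ∈ E, IsAlgebraic ℚ e) ∧
        ∀ x y : ℝ, x < y → (∀ e ∈ E, e ∉ Set.Icc x y) → ((fun _ => x) ∈ σ ↔ (fun _ => y) ∈ σ)) ∧
      (∀ (f : ℝ → ℝ) (a b : ℝ), a < b →
        IsSemialgebraicFunOn ℚ {z : Fin 1 → ℝ | z 0 ∈ Set.Ioo a b} (fun z => f (z 0)) →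
        ∃ B : Finset ℝ, (↑B : Set ℝ) ⊆ Set.Ioo a b ∧ (∀ x ∈ B, IsAlgebraic ℚ x) ∧
          ∀ u v : ℝ, u < v → (u = a ∨ u ∈ B) → (v = b ∨ v ∈ B) → (∀ x ∈ B, x ∉ Set.Ioo u v) →
            ∃ P : MvPolynomial (Fin 2) ℝ, (∀ d, IsAlgebraic ℚ (P.coeff d)) ∧
              ∀ x ∈ Set.Ioo u v, AnalyticAt ℝ f x ∧ MvPolynomial.eval ![x, f x] P = 0 ∧
                MvPolynomial.eval ![x, f x] (MvPolynomial.pderiv 1 P) ≠ 0 ∧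
                (IsAlgebraic ℚ x → IsAlgebraic ℚ (f x)))) →
    ∀ r : KZ.IntegralRep 1, ∃ (k : ℕ) (g : Fin k → ℝ → ℝ) (G : Fin k → MvPolynomial (Fin 2) ℝ)
      (R : Fin k → KZ.IntegralRep 1),
      (∀ j, (∀ d, IsAlgebraic ℚ ((G j).coeff d)) ∧ (∀ s ∈ Set.Icc (0 : ℝ) 1, AnalyticAt ℝ (g j) s) ∧
        (∀ n, IsAlgebraic ℚ (iteratedDeriv n (g j) 0)) ∧ IsAlgebraic ℚ ((g j) 1) ∧
        IsSemialgebraicFunOn ℚ {z : Fin 1 → ℝ | z 0 ∈ Set.Icc (0 : ℝ) 1} (fun z => (g j) (z 0)) ∧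
        (∀ s ∈ Set.Icc (0 : ℝ) 1, MvPolynomial.eval ![s, (g j) s] (G j) = 0) ∧
        (∀ s ∈ Set.Ioc (0 : ℝ) 1, MvPolynomial.eval ![s, (g j) s] (MvPolynomial.pderiv 1 (G j)) ≠ 0)) ∧
      (∀ j, (R j).domain = {z | z 0 ∈ Set.Ioo (0 : ℝ) 1} ∧ ∀ z ∈ (R j).domain, (R j).integrand z = g j (z 0)) ∧
      KZ.of r - ∑ j, KZ.of (R j) ∈ AddSubgroup.closure (KZ.domainAddRel ∪ KZ.changeOfVariablesRel) := by
  sorry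

/-- STUB `stub_etaleShift` (M). THE ÉTALE TAYLOR SHIFT: for `g` analytic at `0` with algebraic Taylor
coefficients, a root branch on `(0, ε)` of `G ∈ ℚ̄[s, y]` which is étale on `(0, ε)` (`∂_yG(s, g s) ≠ 0`), put
`m = ord₀ ∂_yG(s, g(s))`, `K = m + 1`, `T = ` the Taylor polynomial of `g` of order `< K`, `u = (g − T)/sᴷ`:
then `G(s, T(s) + sᴷy) = sᵉ·G_K(s, y)` with `e = K + m` EXACTLY (the `y¹`-coefficient has order `K + m`, the
`y⁰`-coefficient order `≥ K + m`, the `yʲ`, `j ≥ 2`, coefficients order `≥ 2K > K + m`), so `G_K` is a polynomial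
with algebraic coefficients, `sᴷ ∂_yG(s, T + sᴷy) = sᵉ ∂_yG_K(s, y)`, `G_K(s, u(s)) = 0` and
`∂_yG_K(s, u(s)) = s^{−m} ∂_yG(s, g(s)) → R_m ≠ 0`: the shifted branch `u` ends at an ÉTALE point `(0, u(0))`
of `G_K = 0`, `u(0) = g_K ∈ ℚ̄`. (If `G(s, T + sᴷy) ≡ 0` then `G = 0`, excluded by étaleness.) Checked on 8
branches by kit j009956. [cite: BochnakCosteRoy1998, §8.1] -/
theorem stub_etaleShift : ∀ (g : ℝ → ℝ) (G : MvPolynomial (Fin 2) ℝ), AnalyticAt ℝ g 0 →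
    (∀ n, IsAlgebraic ℚ (iteratedDeriv n g 0)) → (∀ d, IsAlgebraic ℚ (G.coeff d)) →
    (∀ᶠ s in 𝓝[>] (0 : ℝ), MvPolynomial.eval ![s, g s] G = 0) →
    (∀ᶠ s in 𝓝[>] (0 : ℝ), MvPolynomial.eval ![s, g s] (MvPolynomial.pderiv 1 G) ≠ 0) →
    ∃ (K e : ℕ) (T : Polynomial ℝ) (GK : MvPolynomial (Fin 2) ℝ) (u : ℝ → ℝ),
      (∀ i, IsAlgebraic ℚ (T.coeff i)) ∧ (∀ d, IsAlgebraic ℚ (GK.coeff d)) ∧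
      (∀ s y : ℝ, MvPolynomial.eval ![s, Polynomial.eval s T + s ^ K * y] G =
        s ^ e * MvPolynomial.eval ![s, y] GK) ∧
      (∀ s y : ℝ, s ^ K * MvPolynomial.eval ![s, Polynomial.eval s T + s ^ K * y] (MvPolynomial.pderiv 1 G) =
        s ^ e * MvPolynomial.eval ![s, y] (MvPolynomial.pderiv 1 GK)) ∧
      AnalyticAt ℝ u 0 ∧ (∀ᶠ s in 𝓝 (0 : ℝ), g s = Polynomial.eval s T + s ^ K * u s) ∧
      IsAlgebraic ℚ (u 0) ∧ MvPolynomial.eval ![0, u 0] GK = 0 ∧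
      MvPolynomial.eval ![0, u 0] (MvPolynomial.pderiv 1 GK) ≠ 0 := by
  sorry

/-- STUB `stub_sectionSymbol` (M/L). THE SECTION SYMBOL on the standard-étale model. For `G_K ∈ ℚ̄[s,y]`
(real algebraic coefficients), `T ∈ ℚ̄[s]`, `K`, and `u` analytic at every point of `[0,1]`, `ℚ`-semialgebraic
on `[0,1]`, with `G_K(s, u(s)) = 0` and `∂_yG_K(s, u(s)) ≠ 0` on `[0,1]` and `u(0), u(1) ∈ ℚ̄`: the period symbol
`S = (V, ω, γ)` with `V = {G_K = 0, x₂·∂₁G_K = 1} ⊂ 𝔸³` (a SMOOTH AFFINE CURVE over `ℚ̄` for every `G_K`: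
algebraic equations, gradient rows `(∂₀G, ∂₁G, 0)` and `(x₂∂₀∂₁G, x₂∂₁²G, ∂₁G)` of rank 2 wherever
`x₂∂₁G = 1`, non-isolated by the holomorphic IFT `HypersurfaceCover.exists_rootFunction`), the polynomial form
`ω = (T(x₀) + x₀ᴷ x₁) dx₀` and the SECTION `γ(s) = (s, u(s), 1/∂₁G_K(s,u(s)))` (a `C¹` — indeed analytic —
`ℚ`-semialgebraic path on `V` with algebraic end points) has period `∫₀¹ (T(s) + sᴷu(s)) ds` and is realised
(coefficient `1`) by every representation `[∫_{(0,1)} T + sᴷu]`. [cite: HuberWustholz2022, §3.3.1 and Cor. 12.7] -/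
theorem stub_sectionSymbol : ∀ (GK : MvPolynomial (Fin 2) ℝ) (T : Polynomial ℝ) (K : ℕ) (u : ℝ → ℝ),
    (∀ d, IsAlgebraic ℚ (GK.coeff d)) → (∀ i, IsAlgebraic ℚ (T.coeff i)) →
    (∀ s ∈ Set.Icc (0 : ℝ) 1, AnalyticAt ℝ u s) →
    IsSemialgebraicFunOn ℚ {z : Fin 1 → ℝ | z 0 ∈ Set.Icc (0 : ℝ) 1} (fun z => u (z 0)) →
    (∀ s ∈ Set.Icc (0 : ℝ) 1, MvPolynomial.eval ![s, u s] GK = 0) →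
    (∀ s ∈ Set.Icc (0 : ℝ) 1, MvPolynomial.eval ![s, u s] (MvPolynomial.pderiv 1 GK) ≠ 0) →
    IsAlgebraic ℚ (u 0) → IsAlgebraic ℚ (u 1) →
    ∃ S : PeriodSymbol,
      S.Z = (⟨3, 2, ![MvPolynomial.rename Fin.castSucc (MvPolynomial.map (algebraMap ℝ ℂ) GK),
        MvPolynomial.X 2 * MvPolynomial.rename Fin.castSucc
          (MvPolynomial.pderiv 1 (MvPolynomial.map (algebraMap ℝ ℂ) GK)) - 1]⟩ : CurveData) ∧
      IsSemialgebraicMapOn ℚ {z : Fin 1 → ℝ | z 0 ∈ Set.Icc (0 : ℝ) 1}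
        (fun z => Fin.append (fun i => (S.γ.toFun (z 0) i).re) (fun i => (S.γ.toFun (z 0) i).im)) ∧
      S.period = ((∫ s in (0 : ℝ)..1, (Polynomial.eval s T + s ^ K * u s) : ℝ) : ℂ) ∧
      ∀ r : KZ.IntegralRep 1, r.domain = {z | z 0 ∈ Set.Ioo (0 : ℝ) 1} →
        (∀ z ∈ r.domain, r.integrand z = Polynomial.eval (z 0) T + (z 0) ^ K * u (z 0)) →
        (r.domain = {z | z 0 ∈ Set.Ioo (0 : ℝ) 1} ∧ ∀ z ∈ r.domain, r.integrand z =
          ((1 : ℂ) * ∑ i, MvPolynomial.eval (S.γ.toFun (z 0)) (S.ω i) *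
            deriv (fun t => S.γ.toFun t i) (z 0)).re) := by
  sorry

/-- STUB `stub_normalisation` (L — glue, `Ψ`). Granted piece reduction (= conclusion of `stub_pieceReduction`),
the étale shift (= `stub_etaleShift`) and the section symbol (= `stub_sectionSymbol`): every `c ∈ H₁` is,
modulo `M₁`, a finite sum of real realisations of period symbols of curve type along `ℚ`-semialgebraic paths,
with algebraic (here: integer) coefficients and the same evaluation. Generators `c = [r]`: reduce `r` to
standard pieces `(g_j, G_j, R_j)`; shift each at `s = 0` (`K, e, T, G_K, u`); the GLOBAL section is
`ũ(s) = (g_j(s) − T(s))/sᴷ` on `(0,1]`, `ũ(0) = u(0)` (`= u` near `0`, so analytic at `0`; `G_K(s, ũ s) = 0`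
and `∂_yG_K(s, ũ s) ≠ 0` on `[0,1]` from the two shift identities and `s ≠ 0`; `ũ(1) = g_j(1) − T(1) ∈ ℚ̄`);
the section symbol `S_j` realises `R_j` with coefficient `1`; `C = Σ_j 𝟙_{S_j}` (multiplicities handled by
1b: integrands agreeing on the domain, integer multiples), `evalCombination C = Σ_j ∫₀¹ g_j = eval c`
(soundness of 1a/2, `KZ.eval_eq_zero_of_mem_*`). Closure under `0`, `−`, `+`: negate / add the realising
integrands (1b; cancelled symbols leave `[u] + [−u] ≡ 0`). [cite: HuberWustholz2022, Prop. 12.5] -/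
theorem stub_normalisation :
    (∀ r : KZ.IntegralRep 1, ∃ (k : ℕ) (g : Fin k → ℝ → ℝ) (G : Fin k → MvPolynomial (Fin 2) ℝ)
      (R : Fin k → KZ.IntegralRep 1),
      (∀ j, (∀ d, IsAlgebraic ℚ ((G j).coeff d)) ∧ (∀ s ∈ Set.Icc (0 : ℝ) 1, AnalyticAt ℝ (g j) s) ∧
        (∀ n, IsAlgebraic ℚ (iteratedDeriv n (g j) 0)) ∧ IsAlgebraic ℚ ((g j) 1) ∧
        IsSemialgebraicFunOn ℚ {z : Fin 1 → ℝ | z 0 ∈ Set.Icc (0 : ℝ) 1} (fun z => (g j) (z 0)) ∧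
        (∀ s ∈ Set.Icc (0 : ℝ) 1, MvPolynomial.eval ![s, (g j) s] (G j) = 0) ∧
        (∀ s ∈ Set.Ioc (0 : ℝ) 1, MvPolynomial.eval ![s, (g j) s] (MvPolynomial.pderiv 1 (G j)) ≠ 0)) ∧
      (∀ j, (R j).domain = {z | z 0 ∈ Set.Ioo (0 : ℝ) 1} ∧ ∀ z ∈ (R j).domain, (R j).integrand z = g j (z 0)) ∧
      KZ.of r - ∑ j, KZ.of (R j) ∈ AddSubgroup.closure (KZ.domainAddRel ∪ KZ.changeOfVariablesRel)) →
    (∀ (g : ℝ → ℝ) (G : MvPolynomial (Fin 2) ℝ), AnalyticAt ℝ g 0 →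
      (∀ n, IsAlgebraic ℚ (iteratedDeriv n g 0)) → (∀ d, IsAlgebraic ℚ (G.coeff d)) →
      (∀ᶠ s in 𝓝[>] (0 : ℝ), MvPolynomial.eval ![s, g s] G = 0) →
      (∀ᶠ s in 𝓝[>] (0 : ℝ), MvPolynomial.eval ![s, g s] (MvPolynomial.pderiv 1 G) ≠ 0) →
      ∃ (K e : ℕ) (T : Polynomial ℝ) (GK : MvPolynomial (Fin 2) ℝ) (u : ℝ → ℝ),
        (∀ i, IsAlgebraic ℚ (T.coeff i)) ∧ (∀ d, IsAlgebraic ℚ (GK.coeff d)) ∧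
        (∀ s y : ℝ, MvPolynomial.eval ![s, Polynomial.eval s T + s ^ K * y] G =
          s ^ e * MvPolynomial.eval ![s, y] GK) ∧
        (∀ s y : ℝ, s ^ K * MvPolynomial.eval ![s, Polynomial.eval s T + s ^ K * y] (MvPolynomial.pderiv 1 G) =
          s ^ e * MvPolynomial.eval ![s, y] (MvPolynomial.pderiv 1 GK)) ∧
        AnalyticAt ℝ u 0 ∧ (∀ᶠ s in 𝓝 (0 : ℝ), g s = Polynomial.eval s T + s ^ K * u s) ∧
        IsAlgebraic ℚ (u 0) ∧ MvPolynomial.eval ![0, u 0] GK = 0 ∧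
        MvPolynomial.eval ![0, u 0] (MvPolynomial.pderiv 1 GK) ≠ 0) →
    (∀ (GK : MvPolynomial (Fin 2) ℝ) (T : Polynomial ℝ) (K : ℕ) (u : ℝ → ℝ),
      (∀ d, IsAlgebraic ℚ (GK.coeff d)) → (∀ i, IsAlgebraic ℚ (T.coeff i)) →
      (∀ s ∈ Set.Icc (0 : ℝ) 1, AnalyticAt ℝ u s) →
      IsSemialgebraicFunOn ℚ {z : Fin 1 → ℝ | z 0 ∈ Set.Icc (0 : ℝ) 1} (fun z => u (z 0)) →
      (∀ s ∈ Set.Icc (0 : ℝ) 1, MvPolynomial.eval ![s, u s] GK = 0) →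
      (∀ s ∈ Set.Icc (0 : ℝ) 1, MvPolynomial.eval ![s, u s] (MvPolynomial.pderiv 1 GK) ≠ 0) →
      IsAlgebraic ℚ (u 0) → IsAlgebraic ℚ (u 1) →
      ∃ S : PeriodSymbol,
        S.Z = (⟨3, 2, ![MvPolynomial.rename Fin.castSucc (MvPolynomial.map (algebraMap ℝ ℂ) GK),
          MvPolynomial.X 2 * MvPolynomial.rename Fin.castSucc
            (MvPolynomial.pderiv 1 (MvPolynomial.map (algebraMap ℝ ℂ) GK)) - 1]⟩ : CurveData) ∧
        IsSemialgebraicMapOn ℚ {z : Fin 1 → ℝ | z 0 ∈ Set.Icc (0 : ℝ) 1}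
          (fun z => Fin.append (fun i => (S.γ.toFun (z 0) i).re) (fun i => (S.γ.toFun (z 0) i).im)) ∧
        S.period = ((∫ s in (0 : ℝ)..1, (Polynomial.eval s T + s ^ K * u s) : ℝ) : ℂ) ∧
        ∀ r : KZ.IntegralRep 1, r.domain = {z | z 0 ∈ Set.Ioo (0 : ℝ) 1} →
          (∀ z ∈ r.domain, r.integrand z = Polynomial.eval (z 0) T + (z 0) ^ K * u (z 0)) →
          (r.domain = {z | z 0 ∈ Set.Ioo (0 : ℝ) 1} ∧ ∀ z ∈ r.domain, r.integrand z =
            ((1 : ℂ) * ∑ i, MvPolynomial.eval (S.γ.toFun (z 0)) (S.ω i) *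
              deriv (fun t => S.γ.toFun t i) (z 0)).re)) →
    ∀ c : KZ.FormalRep, c ∈ H₁ →
      ∃ (C : PeriodSymbol →₀ ℂ) (R : PeriodSymbol → KZ.IntegralRep 1), (∀ s, IsAlgebraic ℚ (C s)) ∧
        (∀ s ∈ C.support, IsSemialgebraicMapOn ℚ {z : Fin 1 → ℝ | z 0 ∈ Set.Icc (0 : ℝ) 1}
          (fun z => Fin.append (fun i => (s.γ.toFun (z 0) i).re) (fun i => (s.γ.toFun (z 0) i).im))) ∧
        (∀ s ∈ C.support, (R s).domain = {z | z 0 ∈ Set.Ioo (0 : ℝ) 1} ∧ ∀ z ∈ (R s).domain,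
          (R s).integrand z = (C s * ∑ i, MvPolynomial.eval (s.γ.toFun (z 0)) (s.ω i) *
            deriv (fun t => s.γ.toFun t i) (z 0)).re) ∧
        evalCombination C = ((KZ.eval c : ℝ) : ℂ) ∧ c - ∑ s ∈ C.support, KZ.of (R s) ∈ M₁ := by
  sorry

/-- STUB `stub_realisation` (XL — the Θ-half shared by every line of this crux; VERBATIM the conclusion of
`stub_retraction` of the sibling crux stmt-10042's line `nash-retraction-thin-strip`, reshape 2, so it is
discharged by that line's `stub_saHomotopic`, `stub_homotopyInvariance`, `stub_exactDimOne`, `stub_realises`,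
`stub_retraction` once they land). There is `Θ : ℂ → PeriodSymbol → FormalRep` — `Θ a (Z, ω, γ) =
[∫₀¹ Re(a·ω(γ̃)γ̃′)]` along a chosen `ℚ`-semialgebraic `C¹` representative `γ̃` of the homotopy class of `γ` rel
end points — which (i) kills every `ℚ̄`-combination of elementary relations R1–R5 modulo `M₁` (R1 = 1b, R2 = zero
integrand, R3 = exactness in dimension one, R4 = chain rule + homotopy coherence on `Z′`, R5 = concatenation +
homotopy coherence; complex algebraic multipliers via `Re(ab·) = Re a·Re(b·) − Im a·Re(ib·)`) and (ii) agrees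
modulo `M₁` with every real realisation along a semialgebraic symbol path. [cite: HuberWustholz2022, Thm 13.3 (2)] -/
theorem stub_realisation : ∃ Θ : ℂ → PeriodSymbol → KZ.FormalRep,
    (∀ (k : ℕ) (ρ : Fin k → (PeriodSymbol →₀ ℂ)) (a : Fin k → ℂ), (∀ l, IsElementaryRelation (ρ l)) →
      (∀ l, IsAlgebraic ℚ (a l)) → ((∑ l, a l • ρ l).sum fun s b => Θ b s) ∈ M₁) ∧
    (∀ (s : PeriodSymbol) (a : ℂ), IsAlgebraic ℚ a →
      IsSemialgebraicMapOn ℚ {z : Fin 1 → ℝ | z 0 ∈ Set.Icc (0 : ℝ) 1}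
        (fun z => Fin.append (fun i => (s.γ.toFun (z 0) i).re) (fun i => (s.γ.toFun (z 0) i).im)) →
      ∀ (r : KZ.IntegralRep 1),
        (r.domain = {z | z 0 ∈ Set.Ioo (0 : ℝ) 1} ∧ ∀ z ∈ r.domain, r.integrand z =
          (a * ∑ i, MvPolynomial.eval (s.γ.toFun (z 0)) (s.ω i) * deriv (fun u => s.γ.toFun u i) (z 0)).re) →
        Θ a s - KZ.of r ∈ M₁) := by
  sorry

/-! ## Composition (sorry-free): the stubs imply the crux -/

/-- Piece reduction, unconditionally from the two structure stubs. [cite: KontsevichZagier2001, §1.2] -/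
theorem pieceReduction : ∀ r : KZ.IntegralRep 1, ∃ (k : ℕ) (g : Fin k → ℝ → ℝ)
    (G : Fin k → MvPolynomial (Fin 2) ℝ) (R : Fin k → KZ.IntegralRep 1),
    (∀ j, (∀ d, IsAlgebraic ℚ ((G j).coeff d)) ∧ (∀ s ∈ Set.Icc (0 : ℝ) 1, AnalyticAt ℝ (g j) s) ∧
      (∀ n, IsAlgebraic ℚ (iteratedDeriv n (g j) 0)) ∧ IsAlgebraic ℚ ((g j) 1) ∧
      IsSemialgebraicFunOn ℚ {z : Fin 1 → ℝ | z 0 ∈ Set.Icc (0 : ℝ) 1} (fun z => (g j) (z 0)) ∧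
      (∀ s ∈ Set.Icc (0 : ℝ) 1, MvPolynomial.eval ![s, (g j) s] (G j) = 0) ∧
      (∀ s ∈ Set.Ioc (0 : ℝ) 1, MvPolynomial.eval ![s, (g j) s] (MvPolynomial.pderiv 1 (G j)) ≠ 0)) ∧
    (∀ j, (R j).domain = {z | z 0 ∈ Set.Ioo (0 : ℝ) 1} ∧ ∀ z ∈ (R j).domain, (R j).integrand z = g j (z 0)) ∧
    KZ.of r - ∑ j, KZ.of (R j) ∈ AddSubgroup.closure (KZ.domainAddRel ∪ KZ.changeOfVariablesRel) :=
  stub_pieceReduction stub_puiseuxGerm stub_saPieceFacts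

/-- NORMALISATION `Ψ`, unconditionally from the stubs of the line. [cite: HuberWustholz2022, Prop. 12.5] -/
theorem normalisation : ∀ c : KZ.FormalRep, c ∈ H₁ →
    ∃ (C : PeriodSymbol →₀ ℂ) (R : PeriodSymbol → KZ.IntegralRep 1), (∀ s, IsAlgebraic ℚ (C s)) ∧
      (∀ s ∈ C.support, IsSemialgebraicMapOn ℚ {z : Fin 1 → ℝ | z 0 ∈ Set.Icc (0 : ℝ) 1}
        (fun z => Fin.append (fun i => (s.γ.toFun (z 0) i).re) (fun i => (s.γ.toFun (z 0) i).im))) ∧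
      (∀ s ∈ C.support, (R s).domain = {z | z 0 ∈ Set.Ioo (0 : ℝ) 1} ∧ ∀ z ∈ (R s).domain,
        (R s).integrand z = (C s * ∑ i, MvPolynomial.eval (s.γ.toFun (z 0)) (s.ω i) *
          deriv (fun t => s.γ.toFun t i) (z 0)).re) ∧
      evalCombination C = ((KZ.eval c : ℝ) : ℂ) ∧ c - ∑ s ∈ C.support, KZ.of (R s) ∈ M₁ :=
  stub_normalisation pieceReduction stub_etaleShift stub_sectionSymbol

/-- **The crux `CurvePeriodsTransfer` from the stubs of line `standard-etale-models`.** Normalise `c ∈ H₁`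
to `Σ_s [R s]` with `Ψ(c) = C` (`normalisation`); `eval c = 0` gives `evalCombination C = 0`, so the
Huber–Wüstholz body (the crux's antecedent) writes `C = Σ aₗ ρₗ` with elementary `ρₗ` and algebraic `aₗ`; the
realisation `Θ` (`stub_realisation`) kills `Σ aₗ ρₗ` and agrees with each `[R s]` modulo `M₁`; hence `c ∈ M₁`.
[cite: HuberWustholz2022, Thm 13.3 (2)] -/
theorem CurvePeriodsTransfer_of :
    Summit.KontsevichZagierPeriods.KontsevichZagierPeriods.Theses.SymplecticScissors.CurvePeriodsTransfer := by
  unfold Summit.KontsevichZagierPeriods.KontsevichZagierPeriods.Theses.SymplecticScissors.CurvePeriodsTransfer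
  intro hHW c hc heval
  change c ∈ M₁
  obtain ⟨C, R, hCalg, hSA, hReal, hCeval, hcR⟩ := normalisation c hc
  have hC0 : evalCombination C = 0 := by rw [hCeval, heval]; simp
  obtain ⟨k, ρ, a, hρ, ha, hCsum⟩ := hHW C hCalg hC0
  obtain ⟨Θ, hΘrel, hΘreal⟩ := stub_realisation
  -- `Σ_{s ∈ supp C} Θ (C s) s ∈ M₁`
  have h1 : (∑ s ∈ C.support, Θ (C s) s) ∈ M₁ := by
    have h := hΘrel k ρ a hρ ha
    rw [← hCsum] at h
    exact h
  -- each `Θ (C s) s − [R s] ∈ M₁`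
  have h2 : (∑ s ∈ C.support, (Θ (C s) s - KZ.of (R s))) ∈ M₁ :=
    sum_mem fun s hs => hΘreal s (C s) (hCalg s) (hSA s hs) (R s) (hReal s hs)
  have h3 : c = (c - ∑ s ∈ C.support, KZ.of (R s)) - (∑ s ∈ C.support, (Θ (C s) s - KZ.of (R s))) +
      ∑ s ∈ C.support, Θ (C s) s := by
    rw [Finset.sum_sub_distrib]
    abel
  rw [h3]
  exact M₁.add_mem (M₁.sub_mem hcR h2) h1

end Summit.KontsevichZagierPeriods.SymplecticScissors.CurvePeriodsTransfer

end
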